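import Literature.NumberTheory.DiophantineGeometry.GLPolynomialRepSemisimpleProofs
import Literature.NumberTheory.DiophantineGeometry.SchurWeylPlethysmOrbitWeightsProofs
import Literature.Computability.AlgebraicComplexity.MultiplicityObstructions
import Literature.Computability.AlgebraicComplexity.GCTObstructions
import Mathlib.LinearAlgebra.Matrix.MvPolynomial
import Mathlib.Algebra.MvPolynomial.Monad
import HarnessLib

/-!
# The multiplicity-obstruction principle — discharge of `orbitMultiplicity_le_of_mem_orbitClosure`
(trunk T-CPLX-ALG; Bläser–Ikenmeyer, *Introduction to Geometric Complexity Theory*, §12.4)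

`MultiplicityObstructions.lean` records as a named fact
(`Literature.CplxAlg.orbitMultiplicity_le_of_mem_orbitClosure : Prop`) the multiplicity-obstruction
principle of geometric complexity theory: in characteristic zero, for forms `f, g` of degree
`m ≠ 0` with `g ∈ Δ[f]`, every highest weight `χ` has
`mult_χ k[Δ_m[g]] ≤ mult_χ k[Δ_m[f]]`, where `mult_χ = orbitMultiplicity k · m χ` is the dimension of
the space of highest-weight vectors (`B`-semi-invariants) of weight `χ` in the coordinate ring of
the orbit closure. This file proves it:

* `Literature.CplxAlg.orbitMultiplicity_le_of_mem_orbitClosure_holds : orbitMultiplicity_le_of_mem_orbitClosure`.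

Source: Bläser–Ikenmeyer, Theory of Computing Graduate Surveys 10 (2025), §12.4 (PDF p. 74):
"`I(Z)_δ ⊆ I(Z₀)_δ` and thus we obtain a canonical `GL_{n²}`-equivariant surjection
`ℂ[Z]_δ ↠ ℂ[Z₀]_δ`. By Schur's lemma (Cor. 12.6) this implies `mult_λ(ℂ[Z]) ≥ mult_λ(ℂ[Z₀])`",
with Cor. 12.6 (p. 72: "If `U ↠ V` is a `G`-equivariant surjection of representations, then
`mult_W(U) ≥ mult_W(V)`") and Prop. 12.7 (p. 72: "`mult_λ(V) = dim HWV_λ(V)`"), both resting on the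
complete reducibility of polynomial `GL_N`-representations (Thm. 10.9, whose proof the survey omits).
The formal proof supplies that input algebraically and follows this architecture:

* §1 `k[Sym^m (k^σ)]` and `k[Δ_m[f]]` are completely reducible `GL σ k`-representations in
  characteristic zero (`isSemisimpleRepresentation_coordRep`, `isSemisimpleRepresentation_orbitCoordRep`):
  the degree piece `k[Sym^m]_n` twisted by the inverse-transpose automorphism `θ(g) = (gᵀ)⁻¹` of
  `GL σ k` (the tree's action `coordSubst` substitutes through `g⁻¹`, so the twisted action is
  `(g F)(h) = F(gᵀ h)`, which is exactly the survey's action (9.1) on `ℂ[𝔸]_δ`) is a polynomial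
  representation (the survey's Example 11.2 / Prop. 3.21: its matrix coefficients are
  specialisations of a generic substitution over `k[Mat_σ]`, `map_eval_aeval_genericSubst`) — hence
  completely reducible by `isSemisimpleRepresentation_of_forall_exists_eval` (file
  `GLPolynomialRepSemisimpleProofs`, Etingof et al. Thm. 4.66 via Schur–Weyl); the twist does not
  change the stable subspaces (`isSemisimpleRepresentation_comp_iff`), the ring is the sum of its
  degree pieces, and `k[Δ_m[f]]` is an equivariant quotient. (`θ` and the degree pieces are built
  inside the proof of `isSemisimpleRepresentation_coordRep`; no definitions are introduced.)
* §2 (Cor. 12.6 with Prop. 12.7, in highest-weight-vector form) along an equivariant surjection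
  `π : V ↠ W` out of a completely reducible `V`, highest-weight vectors lift: the kernel has a stable
  complement `C ≅ W` and the preimage in `C` of a semi-invariant is a semi-invariant
  (`map_highestWeightSpace_eq_of_surjective`), so `dim HWV_χ(W) ≤ dim HWV_χ(V)` when the latter is
  finite (`hwMultiplicity_le_of_surjective`); likewise `π` has an equivariant section
  (`exists_section_of_surjective`).
* §3 the principle: restriction `k[Δ_m[f]] ↠ k[Δ_m[g]]` (`orbitCoordRestrict`, file
  `GCTObstructions`, bundled inside the proof as an intertwining map) is an equivariant surjection, and highest-weight spaces of `k[Δ_m[f]]` are finite-dimensional for `m ≠ 0`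
  (`finiteDimensional_highestWeightSpace_orbitCoordRep_holds`, file
  `SchurWeylPlethysmOrbitWeightsProofs`). The same argument with the quotient map
  `k[Sym^m] ↠ k[Δ_m[f]]` discharges the sibling fact `orbitMultiplicity_le_plethysmCoeff` of
  `SchurWeylPlethysm.lean` (BLMW 2011 §4.4, §5.2; its occurrence form
  `hasHighestWeight_coordRep_of_orbitCoordRep` is discharged independently, by polarization, in
  `Polarization.lean`), and the section lemma discharges
  `hasMultiplicityObstruction_of_hasOccurrenceObstruction_complex` of `GCTObstructions.lean` (BIP 2019
  §1: occurrence obstructions are multiplicity obstructions).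

## References

* M. Bläser, C. Ikenmeyer, *Introduction to Geometric Complexity Theory*, Theory of Computing
  Graduate Surveys 10 (2025) 1–166, doi:10.4086/toc.gs.2025.010: (9.1) (p. 55), Thm. 10.9 (p. 61),
  Def. 11.1, Example 11.2 (p. 62), Def. 12.4, Cor. 12.6, Prop. 12.7 (p. 72), Lemma 12.11, §12.4
  (p. 74). [BlaeserIkenmeyer2025]
* P. Bürgisser, J. M. Landsberg, L. Manivel, J. Weyman, *An overview of mathematical issues arising
  in the geometric complexity theory approach to VP ≠ VNP*, SIAM J. Comput. 40 (2011), §4.4, §5.2.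
  [BurgisserEtAl2011]
* P. Bürgisser, C. Ikenmeyer, G. Panova, *No occurrence obstructions in geometric complexity
  theory*, J. AMS 32 (2019), §1. [BurgisserIkenmeyerPanova2019]
* P. Etingof et al., *Introduction to representation theory*, AMS (2011), arXiv:0901.0827,
  Thm. 4.66. [EtingofEtAl2011]

## Mathlib and tree

Mathlib: `Representation.IsSemisimpleRepresentation` (`= ComplementedLattice (Subrepresentation ρ)`,
`exists_isCompl`), `Representation.IntertwiningMap` (`ker`, `comp`), `Matrix.mvPolynomialX`,
`MvPolynomial.map_bind₁`, `weightedHomogeneousSubmodule_fg`, `LinearEquiv.ofBijective`,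
`Submodule.finrank_map_le`. Tree: `coordRep`, `coordSubst`, `orbitCoordRep`, `OrbitCoordRing`
(`OrbitCoordinateRing`), `orbitCoordRingDeg`, `orbitCoordSubrep`, `orbitCoordRestrict`,
`isHomogeneous_coordSubst` (`GCTObstructions`), `linSubst` (`LinSubst`), `highestWeightSpace`,
`hwMultiplicity`, `HasHighestWeight`, `IsPolynomialRep`, `highestWeightSpace_le_comap_intertwiningMap`
(`GLHighestWeight`), `orbitMultiplicity`, `plethysmCoeff` (`SchurWeylPlethysm`),
`isSemisimpleRepresentation_of_forall_exists_eval` and the transfer lemmas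
(`GLPolynomialRepSemisimpleProofs`), `finiteDimensional_highestWeightSpace_(orbit)CoordRep_holds`
(`SchurWeylPlethysmOrbitWeightsProofs`).

## Design

`namespace Literature.CplxAlg`; theorems only, no definitions. §1 is written for `[DecidableEq σ]` (no
linear order), so that it also serves `GCTObstructions.lean`, whose facts quantify over
`[DecidableEq σ]`; the polynomiality of the twisted pieces is therefore used in the unfolded form of
`isSemisimpleRepresentation_of_forall_exists_eval`. Iterated coordinate types `DegIdx (DegIdx σ m) n`
are never written out (their index finset unfolds badly under `whnf`); functionals on degree pieces
are expanded through `exists_dual_homogeneousSubmodule_eq_sum` with an abstract index finset.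
-/

noncomputable section

open scoped BigOperators Matrix

namespace Literature.Computability.AlgebraicComplexity

open MvPolynomial


/-! ### Base change of linear substitutions and the generic twisted substitution -/

section GenericSubst

variable {σ : Type*} [Fintype σ] {R S : Type*} [CommRing R] [CommRing S]

/-- Base change of linear substitutions along a ring homomorphism:
`f_*(A · p) = f(A) · f_*(p)`. [folklore] -/
theorem map_linSubst (f : R →+* S) (A : Matrix σ σ R) (p : MvPolynomial σ R) :
    map f (linSubst σ R A p) = linSubst σ S (A.map f) (map f p) := by
  change map f (aeval _ p) = aeval _ (map f p)
  rw [aeval_eq_bind₁, aeval_eq_bind₁, map_bind₁]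
  congr 2
  funext i
  simp only [map_sum, smul_eq_C_mul, map_mul, map_C, map_X, Matrix.map_apply]

variable [DecidableEq σ] {k : Type*} [Field k]

/-- **Specialisation of the generic twisted substitution** (the content of Bläser–Ikenmeyer
Example 11.2 / Prop. 3.21: the coordinate functions of `(g, h) ↦ g h` are polynomials). With the
generic matrix `Y = (X_{(i,j)})` over `k[Mat_σ]` (Mathlib `Matrix.mvPolynomialX`), substituting
`X_d ↦ ∑_e coeff_d (Yᵀ · X^e) X_e` and then evaluating the coefficients at the entries of `g` is
substituting `X_d ↦ ∑_e coeff_d (gᵀ · X^e) X_e`. [cite: BlaeserIkenmeyer2025, Prop. 3.21 with Example 11.2] -/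
theorem map_eval_aeval_genericSubst (m : ℕ) (g : GL σ k) (F : MvPolynomial (DegIdx σ m) k) :
    map (eval fun ij : σ × σ => (g : Matrix σ σ k) ij.1 ij.2)
      (aeval (fun d : DegIdx σ m => ∑ e : DegIdx σ m,
        C (coeff d.1 (linSubst σ (MvPolynomial (σ × σ) k) (Matrix.mvPolynomialX σ σ k)ᵀ
          (monomial e.1 1))) * X e) F) =
      aeval (fun d : DegIdx σ m => ∑ e : DegIdx σ m,
        coeff d.1 (linSubst σ k ((g : Matrix σ σ k)ᵀ) (monomial e.1 1)) • X e) F := by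
  set ev : MvPolynomial (σ × σ) k →+* k := eval fun ij : σ × σ => (g : Matrix σ σ k) ij.1 ij.2
    with hev
  have hY : ((Matrix.mvPolynomialX σ σ k)ᵀ).map ev = ((g : GL σ k) : Matrix σ σ k)ᵀ := by
    ext i j
    simp [hev, Matrix.map_apply, Matrix.transpose_apply]
  have hq : ∀ d e : DegIdx σ m,
      ev (coeff d.1 (linSubst σ (MvPolynomial (σ × σ) k) (Matrix.mvPolynomialX σ σ k)ᵀ
        (monomial e.1 1))) = coeff d.1 (linSubst σ k ((g : Matrix σ σ k)ᵀ) (monomial e.1 1)) := by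
    intro d e
    rw [← coeff_map, map_linSubst, hY, map_monomial, map_one]
  suffices h : (map ev).comp (aeval (fun d : DegIdx σ m => ∑ e : DegIdx σ m,
        C (coeff d.1 (linSubst σ (MvPolynomial (σ × σ) k) (Matrix.mvPolynomialX σ σ k)ᵀ
          (monomial e.1 1))) * X e)).toRingHom =
      (aeval (fun d : DegIdx σ m => ∑ e : DegIdx σ m,
        coeff d.1 (linSubst σ k ((g : Matrix σ σ k)ᵀ) (monomial e.1 1)) • X e) :
          MvPolynomial (DegIdx σ m) k →ₐ[k] MvPolynomial (DegIdx σ m) k).toRingHom from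
    RingHom.congr_fun h F
  refine MvPolynomial.ringHom_ext (fun c => ?_) (fun d => ?_)
  · simp only [RingHom.comp_apply, AlgHom.toRingHom_eq_coe, RingHom.coe_coe, aeval_C,
      MvPolynomial.algebraMap_apply, MvPolynomial.algebraMap_eq, map_C, hev, eval_C]
  · simp only [RingHom.comp_apply, AlgHom.toRingHom_eq_coe, RingHom.coe_coe, aeval_X, map_sum,
      map_mul, map_C, map_X, hq, smul_eq_C_mul]

end GenericSubst

/-! ### Functionals on degree pieces -/

section DegreePieces

variable {k : Type*} [Field k]

/-- A linear functional on the degree-`n` forms is a fixed linear combination of coefficient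
functionals: `φ x = ∑_u coeff_u x · φ(X^u)`. [folklore] -/
theorem dual_homogeneousSubmodule_apply {τ : Type*} [Fintype τ] [DecidableEq τ] (n : ℕ)
    (φ : Module.Dual k (homogeneousSubmodule τ k n)) (x : homogeneousSubmodule τ k n) :
    φ x = ∑ u : DegIdx τ n, coeff u.1 (x : MvPolynomial τ k) *
      φ ⟨monomial u.1 1, (mem_homogeneousSubmodule n _).mpr
        (isHomogeneous_monomial _ (mem_degMonomials_iff.mp u.2))⟩ := by
  have hx : x = ∑ u : DegIdx τ n, coeff u.1 (x : MvPolynomial τ k) •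
      (⟨monomial u.1 1, (mem_homogeneousSubmodule n _).mpr
        (isHomogeneous_monomial _ (mem_degMonomials_iff.mp u.2))⟩ : homogeneousSubmodule τ k n) := by
    apply Subtype.ext
    rw [Submodule.coe_sum]
    simp only [Submodule.coe_smul]
    exact (sum_coeff_smul_monomial_eq ((mem_homogeneousSubmodule n _).mp x.2)).symm
  conv_lhs => rw [hx]
  simp only [map_sum, map_smul, smul_eq_mul]

/-- The same, with the finite index set and the coefficients abstracted (the form used for
iterated coordinate types, whose explicit index finset must not be unfolded). [folklore] -/
theorem exists_dual_homogeneousSubmodule_eq_sum {τ : Type*} [Fintype τ] [DecidableEq τ] (n : ℕ)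
    (φ : Module.Dual k (homogeneousSubmodule τ k n)) :
    ∃ (D : Finset (τ →₀ ℕ)) (c : (τ →₀ ℕ) → k), ∀ x : homogeneousSubmodule τ k n,
      φ x = ∑ d ∈ D, coeff d (x : MvPolynomial τ k) * c d := by
  classical
  refine ⟨degMonomials τ n, fun d => if h : d ∈ degMonomials τ n then
    φ ⟨monomial d 1, (mem_homogeneousSubmodule n _).mpr
      (isHomogeneous_monomial _ (mem_degMonomials_iff.mp h))⟩ else 0, fun x => ?_⟩
  rw [dual_homogeneousSubmodule_apply n φ x, ← Finset.sum_coe_sort (degMonomials τ n)]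
  refine Finset.sum_congr rfl fun u _ => ?_
  simp only [dif_pos u.2]

/-- Homogeneous polynomials of a fixed degree in finitely many variables form a
finite-dimensional space (Mathlib `homogeneousSubmodule_fg`, as a `Module.Finite` statement).
[folklore] -/
theorem finite_homogeneousSubmodule (τ : Type*) [Finite τ] (R : Type*) [CommSemiring R] (n : ℕ) :
    Module.Finite R (homogeneousSubmodule τ R n) :=
  Module.Finite.iff_fg.mpr (homogeneousSubmodule_fg τ R n)

end DegreePieces

/-! ### Complete reducibility is insensitive to a surjective reparametrisation of the group -/

section CompSurj

variable {k G H V : Type*} [Field k] [Monoid G] [Monoid H] [AddCommGroup V] [Module k V]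

/-- Complete reducibility of `ρ ∘ f` for surjective `f : H →* G` is complete reducibility of `ρ`:
the two representations have the same stable subspaces. [folklore] -/
theorem isSemisimpleRepresentation_comp_iff (ρ : Representation k G V) (f : H →* G)
    (hf : Function.Surjective f) :
    Representation.IsSemisimpleRepresentation (ρ.comp f) ↔ ρ.IsSemisimpleRepresentation := by
  let e : Subrepresentation (ρ.comp f) ≃o Subrepresentation ρ :=
    { toFun := fun W => ⟨W.toSubmodule, fun g v hv => by
        obtain ⟨h, rfl⟩ := hf g
        exact W.apply_mem_toSubmodule h hv⟩
      invFun := fun W => ⟨W.toSubmodule, fun h v hv => W.apply_mem_toSubmodule (f h) hv⟩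
      left_inv := fun _ => rfl
      right_inv := fun _ => rfl
      map_rel_iff' := Iff.rfl }
  exact e.complementedLattice_iff

end CompSurj

/-! ### `k[Sym^m (k^σ)]` and `k[Δ_m[f]]` are completely reducible -/

section CoordSemisimple

variable {σ : Type*} [Fintype σ] [DecidableEq σ] {k : Type*} [Field k]

/-- **`k[Sym^m (k^σ)]` is completely reducible** (characteristic zero). Its degree piece
`k[Sym^m]_n` is `GL σ k`-stable (`isHomogeneous_coordSubst`) and finite-dimensional; twisted by the
inverse-transpose automorphism `θ(g) = (gᵀ)⁻¹` of `GL σ k` (the tree's action `coordSubst`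
substitutes through `g⁻¹`, so the twisted action is `(g F)(h) = F(gᵀ h)`, exactly the survey's action
(9.1) on `ℂ[𝔸]_δ`) it is a polynomial representation (Bläser–Ikenmeyer Example 11.2: its matrix
coefficients are specialisations of the generic substitution, `map_eval_aeval_genericSubst`), hence
completely reducible (`isSemisimpleRepresentation_of_forall_exists_eval`, Etingof et al. Thm. 4.66
via Schur–Weyl); the twist does not change the stable subspaces
(`isSemisimpleRepresentation_comp_iff`), and the ring is the sum of its degree pieces.
Bläser–Ikenmeyer Thm. 10.9 ("`GL_N` is reductive") for `ℂ[𝔸] = ⊕_δ ℂ[𝔸]_δ`.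
[cite: BlaeserIkenmeyer2025, Thm. 10.9 with Example 11.2 and (9.1)] -/
theorem isSemisimpleRepresentation_coordRep [CharZero k] (m : ℕ) :
    (coordRep σ k m).IsSemisimpleRepresentation := by
  -- the inverse-transpose automorphism `θ`
  let θ : GL σ k →* GL σ k :=
    { toFun := fun g =>
        { val := ((g⁻¹ : GL σ k) : Matrix σ σ k)ᵀ
          inv := ((g : GL σ k) : Matrix σ σ k)ᵀ
          val_inv := by rw [← Matrix.transpose_mul, Units.mul_inv, Matrix.transpose_one]
          inv_val := by rw [← Matrix.transpose_mul, Units.inv_mul, Matrix.transpose_one] }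
      map_one' := Units.ext (by simp)
      map_mul' := fun g h => Units.ext (by
        simp only [mul_inv_rev, Units.val_mul, Matrix.transpose_mul]) }
  have hθinv : ∀ g : GL σ k, (((θ g)⁻¹ : GL σ k) : Matrix σ σ k) = ((g : GL σ k) : Matrix σ σ k)ᵀ :=
    fun g => rfl
  have hθsurj : Function.Surjective θ := fun g =>
    ⟨θ g, Units.ext (by
      change ((((θ g)⁻¹ : GL σ k) : Matrix σ σ k))ᵀ = _
      rw [hθinv, Matrix.transpose_transpose])⟩
  -- the degree pieces
  let W : ℕ → Subrepresentation (coordRep σ k m) := fun n =>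
    { toSubmodule := homogeneousSubmodule (DegIdx σ m) k n
      apply_mem_toSubmodule := fun g _ hF =>
        (mem_homogeneousSubmodule n _).mpr
          (isHomogeneous_coordSubst g ((mem_homogeneousSubmodule n _).mp hF)) }
  have hW : ∀ n, (W n).toRepresentation.IsSemisimpleRepresentation := by
    intro n
    haveI : Module.Finite k (W n).toSubmodule := finite_homogeneousSubmodule _ _ _
    -- the twisted piece is a polynomial representation (Bläser–Ikenmeyer Example 11.2)
    have hpoly : ∀ (v : (W n).toSubmodule) (φ : Module.Dual k (W n).toSubmodule),
        ∃ P : MvPolynomial (σ × σ) k, ∀ g : GL σ k,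
          φ (((W n).toRepresentation.comp θ : Representation k (GL σ k) (W n).toSubmodule) g v) =
            eval (fun ij => (g : Matrix σ σ k) ij.1 ij.2) P := by
      intro v φ
      obtain ⟨D, c, hφ⟩ := exists_dual_homogeneousSubmodule_eq_sum n φ
      refine ⟨∑ d ∈ D, coeff d (aeval (fun d : DegIdx σ m => ∑ e : DegIdx σ m,
        C (coeff d.1 (linSubst σ (MvPolynomial (σ × σ) k) (Matrix.mvPolynomialX σ σ k)ᵀ
          (monomial e.1 1))) * X e) (v : MvPolynomial (DegIdx σ m) k)) * C (c d), fun g => ?_⟩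
      have hsub : coordSubst m (θ g) = aeval (fun d : DegIdx σ m => ∑ e : DegIdx σ m,
          coeff d.1 (linSubst σ k ((g : Matrix σ σ k)ᵀ) (monomial e.1 1)) • X e) :=
        MvPolynomial.algHom_ext fun d => by
          rw [coordSubst_X, aeval_X]
          simp only [linSubstRep_apply, hθinv]
      have hv : ((((W n).toRepresentation.comp θ :
          Representation k (GL σ k) (W n).toSubmodule) g v : (W n).toSubmodule) :
            MvPolynomial (DegIdx σ m) k) = coordSubst m (θ g) (v : MvPolynomial (DegIdx σ m) k) :=
        rfl
      refine (hφ _).trans ?_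
      rw [map_sum]
      refine Finset.sum_congr rfl fun d _ => ?_
      rw [map_mul, eval_C, ← coeff_map, map_eval_aeval_genericSubst, ← hsub, ← hv]
    exact (isSemisimpleRepresentation_comp_iff _ θ hθsurj).mp
      (Literature.NumberTheory.DiophantineGeometry.isSemisimpleRepresentation_of_forall_exists_eval hpoly)
  -- the degree pieces generate
  refine Literature.NumberTheory.DiophantineGeometry.isSemisimpleRepresentation_of_subrepresentations {U | ∃ n, U = W n} ?_ ?_
  · rintro U ⟨n, rfl⟩
    exact hW n
  · intro U hU
    apply Subrepresentation.toSubmodule_injective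
    rw [show (⊤ : Subrepresentation (coordRep σ k m)).toSubmodule = ⊤ from rfl, eq_top_iff]
    rintro F -
    rw [← sum_homogeneousComponent F]
    refine Submodule.sum_mem _ fun n _ => ?_
    exact hU _ ⟨n, rfl⟩ (homogeneousComponent_mem n F)

/-- **`k[Δ_m[f]]` is completely reducible** (characteristic zero): it is the `GL`-equivariant
quotient of `k[Sym^m (k^σ)]` by the vanishing ideal of the orbit (the quotient map intertwines
`coordRep` and `orbitCoordRep` by construction, cf. `mkₐ_comp_coordRep`). Bläser–Ikenmeyer §12.4
with Lemma 12.11 ("`ℂ[Z]_δ` is a `G`-representation, `V ≅ U ⊕ V/U`").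
[cite: BlaeserIkenmeyer2025, §12.4 (Lemma 12.11)] -/
theorem isSemisimpleRepresentation_orbitCoordRep [CharZero k] (f : MvPolynomial σ k) (m : ℕ) :
    (orbitCoordRep f m).IsSemisimpleRepresentation :=
  Literature.NumberTheory.DiophantineGeometry.isSemisimpleRepresentation_of_surjective
    (⟨(Ideal.Quotient.mkₐ k (orbitVanishingIdeal f m)).toLinearMap, fun _ => LinearMap.ext fun _ => rfl⟩ :
      (coordRep σ k m).IntertwiningMap (orbitCoordRep f m))
    (Ideal.Quotient.mkₐ_surjective k _) (isSemisimpleRepresentation_coordRep m)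

end CoordSemisimple

/-! ### Highest-weight vectors lift along equivariant surjections from completely reducible
representations -/

section Lifting

variable {σ k V W : Type*} [Fintype σ] [LinearOrder σ] [Field k] [AddCommGroup V] [Module k V]
  [AddCommGroup W] [Module k W] {ρ : Representation k (GL σ k) V} {ρ' : Representation k (GL σ k) W}

/-- **Highest-weight vectors lift along equivariant surjections** out of a completely reducible
representation (the mechanism behind Bläser–Ikenmeyer Cor. 12.6 with Prop. 12.7): if
`π : V ↠ W` is `GL`-equivariant and `V` is completely reducible, the kernel has a stable complement
`C ≅ W`, and the preimage in `C` of a highest-weight vector of `W` is a highest-weight vector of `V`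
of the same weight. Hence `π (HWV_χ(V)) = HWV_χ(W)`.
[cite: BlaeserIkenmeyer2025, Cor. 12.6 with Prop. 12.7] -/
theorem map_highestWeightSpace_eq_of_surjective (π : ρ.IntertwiningMap ρ')
    (hπ : Function.Surjective π) (hρ : ρ.IsSemisimpleRepresentation) (χ : Literature.NumberTheory.DiophantineGeometry.Weight σ) :
    (Literature.NumberTheory.DiophantineGeometry.highestWeightSpace ρ χ).map π.toLinearMap = Literature.NumberTheory.DiophantineGeometry.highestWeightSpace ρ' χ := by
  refine le_antisymm (Submodule.map_le_iff_le_comap.mpr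
    (Literature.NumberTheory.DiophantineGeometry.highestWeightSpace_le_comap_intertwiningMap π χ)) fun w hw => ?_
  -- a stable complement `C` of the kernel
  obtain ⟨C, hC⟩ := hρ.exists_isCompl π.ker
  have hC' : IsCompl π.ker.toSubmodule C.toSubmodule := by
    constructor
    · rw [disjoint_iff]
      have h := hC.1.eq_bot
      exact congrArg Subrepresentation.toSubmodule h
    · rw [codisjoint_iff]
      have h := hC.2.eq_top
      exact congrArg Subrepresentation.toSubmodule h
  -- the preimage of `w` in `C`
  obtain ⟨v, rfl⟩ := hπ w
  obtain ⟨y, hy, z, hz, rfl⟩ := Submodule.mem_sup.mp (hC'.sup_eq_top.symm ▸ Submodule.mem_top (x := v))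
  have hyk : π y = 0 := hy
  refine ⟨z, fun g hg => ?_, by rw [Representation.IntertwiningMap.toLinearMap_apply, map_add, hyk, zero_add]⟩
  -- `ρ g z - χ(g) z` lies in `C` and in the kernel
  have h1 : ρ g z - Literature.NumberTheory.DiophantineGeometry.weightChar χ g • z ∈ C.toSubmodule :=
    C.toSubmodule.sub_mem (C.apply_mem_toSubmodule g hz) (C.toSubmodule.smul_mem _ hz)
  have h2 : ρ g z - Literature.NumberTheory.DiophantineGeometry.weightChar χ g • z ∈ π.ker.toSubmodule := by
    change π (ρ g z - Literature.NumberTheory.DiophantineGeometry.weightChar χ g • z) = 0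
    rw [map_sub, map_smul, Representation.IntertwiningMap.isIntertwining _ _ π g z]
    have hw' := hw g hg
    rw [map_add, hyk, zero_add] at hw'
    rw [hw', sub_self]
  have h3 : ρ g z - Literature.NumberTheory.DiophantineGeometry.weightChar χ g • z = 0 := by
    have := hC'.1
    rw [disjoint_iff] at this
    have hmem : ρ g z - Literature.NumberTheory.DiophantineGeometry.weightChar χ g • z ∈ π.ker.toSubmodule ⊓ C.toSubmodule := ⟨h2, h1⟩
    rw [this] at hmem
    exact hmem
  exact sub_eq_zero.mp h3

/-- Multiplicities do not increase along equivariant surjections out of completely reducible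
representations with finite-dimensional highest-weight spaces (Bläser–Ikenmeyer Cor. 12.6 in the
highest-weight-vector form of Prop. 12.7). [cite: BlaeserIkenmeyer2025, Cor. 12.6 with Prop. 12.7] -/
theorem hwMultiplicity_le_of_surjective (π : ρ.IntertwiningMap ρ') (hπ : Function.Surjective π)
    (hρ : ρ.IsSemisimpleRepresentation) (χ : Literature.NumberTheory.DiophantineGeometry.Weight σ)
    [FiniteDimensional k (Literature.NumberTheory.DiophantineGeometry.highestWeightSpace ρ χ)] :
    Literature.NumberTheory.DiophantineGeometry.hwMultiplicity ρ' χ ≤ Literature.NumberTheory.DiophantineGeometry.hwMultiplicity ρ χ := by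
  unfold Literature.NumberTheory.DiophantineGeometry.hwMultiplicity
  rw [← map_highestWeightSpace_eq_of_surjective π hπ hρ χ]
  exact Submodule.finrank_map_le _ _

/-- Occurrence transfers along equivariant surjections out of completely reducible
representations: a highest weight of the quotient is a highest weight of the source. [folklore] -/
theorem hasHighestWeight_of_surjective (π : ρ.IntertwiningMap ρ') (hπ : Function.Surjective π)
    (hρ : ρ.IsSemisimpleRepresentation) {χ : Literature.NumberTheory.DiophantineGeometry.Weight σ} (h : Literature.NumberTheory.DiophantineGeometry.HasHighestWeight ρ' χ) :
    Literature.NumberTheory.DiophantineGeometry.HasHighestWeight ρ χ := by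
  intro h0
  apply h
  rw [← map_highestWeightSpace_eq_of_surjective π hπ hρ χ, h0, Submodule.map_bot]

end Lifting

/-! ### Occurrence obstructions are multiplicity obstructions -/

section Occurrence

variable {k G V W : Type*} [Field k] [Monoid G] [AddCommGroup V] [Module k V]
  [AddCommGroup W] [Module k W] {ρ : Representation k G V} {ρ' : Representation k G W}

/-- **An equivariant surjection out of a completely reducible representation has an equivariant
section**: a stable complement `C` of the kernel maps isomorphically onto the target, and the
inverse `W ≅ C ⊆ V` is equivariant. (The mechanism of Bläser–Ikenmeyer Lemma 12.11 / Cor. 12.6 and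
of "occurrence obstructions are multiplicity obstructions", BIP 2019 §1.) [folklore] -/
theorem exists_section_of_surjective (π : ρ.IntertwiningMap ρ') (hπ : Function.Surjective π)
    (hρ : ρ.IsSemisimpleRepresentation) :
    ∃ s : ρ'.IntertwiningMap ρ, ∀ w, π (s w) = w := by
  obtain ⟨C, hC⟩ := hρ.exists_isCompl π.ker
  have hC' : IsCompl π.ker.toSubmodule C.toSubmodule :=
    ⟨by rw [disjoint_iff]; exact congrArg Subrepresentation.toSubmodule hC.1.eq_bot,
     by rw [codisjoint_iff]; exact congrArg Subrepresentation.toSubmodule hC.2.eq_top⟩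
  -- `π` restricted to `C` is bijective
  set φ : C.toSubmodule →ₗ[k] W := π.toLinearMap ∘ₗ C.toSubmodule.subtype with hφ
  have hinj : Function.Injective φ := by
    rw [← LinearMap.ker_eq_bot, LinearMap.ker_eq_bot']
    intro c hc
    have hmem : (c : V) ∈ π.ker.toSubmodule ⊓ C.toSubmodule := ⟨hc, c.2⟩
    rw [hC'.1.eq_bot] at hmem
    exact Subtype.ext hmem
  have hsurj : Function.Surjective φ := by
    intro w
    obtain ⟨v, rfl⟩ := hπ w
    obtain ⟨y, hy, z, hz, rfl⟩ :=
      Submodule.mem_sup.mp (hC'.sup_eq_top.symm ▸ Submodule.mem_top (x := v))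
    refine ⟨⟨z, hz⟩, ?_⟩
    have hyk : π y = 0 := hy
    change π z = π (y + z)
    rw [map_add, hyk, zero_add]
  set e := LinearEquiv.ofBijective φ ⟨hinj, hsurj⟩ with he
  have heφ : ∀ c, e c = π (c : V) := fun c => rfl
  refine ⟨⟨C.toSubmodule.subtype ∘ₗ e.symm.toLinearMap, fun g => LinearMap.ext fun w => ?_⟩,
    fun w => ?_⟩
  · -- equivariance of the inverse: test after applying the injective `e`
    change ((e.symm (ρ' g w) : C.toSubmodule) : V) = ρ g ((e.symm w : C.toSubmodule) : V)
    have h1 : ρ g ((e.symm w : C.toSubmodule) : V) ∈ C.toSubmodule :=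
      C.apply_mem_toSubmodule g (e.symm w).2
    suffices h : e.symm (ρ' g w) = ⟨_, h1⟩ from congrArg Subtype.val h
    apply e.injective
    rw [LinearEquiv.apply_symm_apply, heφ]
    change ρ' g w = π (ρ g _)
    rw [Representation.IntertwiningMap.isIntertwining _ _ π g, ← heφ, LinearEquiv.apply_symm_apply]
  · change π ((e.symm w : C.toSubmodule) : V) = w
    rw [← heφ, LinearEquiv.apply_symm_apply]

end Occurrence

/-! ### The multiplicity-obstruction principle, the plethysm bound, occurrence obstructions -/

section Principle

variable {σ : Type*} [Fintype σ] [LinearOrder σ] {k : Type*} [Field k]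

/-- **The multiplicity-obstruction principle** — discharge of the named fact
`orbitMultiplicity_le_of_mem_orbitClosure` (Bläser–Ikenmeyer 2025 §12.4 with Cor. 12.6 and
Prop. 12.7; BLMW 2011 §1; BIP 2019 §1.1). For `g ∈ Δ[f]`, restriction `k[Δ_m[f]] ↠ k[Δ_m[g]]` is a
`GL σ k`-equivariant surjection (`orbitCoordRestrict`, file `GCTObstructions`), `k[Δ_m[f]]` is
completely reducible in characteristic zero (`isSemisimpleRepresentation_orbitCoordRep`, via
Schur–Weyl), so highest-weight vectors lift (`map_highestWeightSpace_eq_of_surjective`) and, the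
highest-weight spaces being finite-dimensional for `m ≠ 0`
(`finiteDimensional_highestWeightSpace_orbitCoordRep_holds`), `mult_χ k[Δ_m[g]] ≤ mult_χ k[Δ_m[f]]`.
[cite: BlaeserIkenmeyer2025, §12.4 (Cor. 12.6, Prop. 12.7)] -/
theorem orbitMultiplicity_le_of_mem_orbitClosure_holds : orbitMultiplicity_le_of_mem_orbitClosure := by
  intro k _ _ σ _ _ f g m hm _ _ h χ
  haveI : FiniteDimensional k (Literature.NumberTheory.DiophantineGeometry.highestWeightSpace (orbitCoordRep f m) χ) :=
    Literature.NumberTheory.DiophantineGeometry.finiteDimensional_highestWeightSpace_orbitCoordRep_holds f hm χ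
  -- restriction as an intertwining map, and its surjectivity
  let π : (orbitCoordRep f m).IntertwiningMap (orbitCoordRep g m) :=
    { toLinearMap := (orbitCoordRestrict m h).toLinearMap
      isIntertwining' := fun A => by
        refine LinearMap.ext fun x => ?_
        obtain ⟨F, rfl⟩ := Ideal.Quotient.mk_surjective x
        simp only [LinearMap.coe_comp, Function.comp_apply, AlgHom.toLinearMap_apply,
          orbitCoordRep_apply, orbitCoordSubst_mk, orbitCoordRestrict_mk] }
  have hπ : Function.Surjective π := by
    intro y
    obtain ⟨F, rfl⟩ := Ideal.Quotient.mk_surjective y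
    exact ⟨Ideal.Quotient.mk _ F, orbitCoordRestrict_mk m h F⟩
  exact hwMultiplicity_le_of_surjective π hπ (isSemisimpleRepresentation_orbitCoordRep f m) χ

/-- **BLMW's plethysm bound** — discharge of the named fact `orbitMultiplicity_le_plethysmCoeff`
(`SchurWeylPlethysm`; BLMW 2011 §4.4, §5.2: the coordinate ring of the orbit closure "is the image
of a surjective map `Sym(V^*) = ℂ[V] → ℂ[\overline{GL(W)·v}]`, given by restriction of polynomial
functions"): `k[Δ_m[f]]` is a `GL`-equivariant quotient of the completely reducible `k[Sym^m (k^σ)]`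
(`isSemisimpleRepresentation_coordRep`), whose highest-weight spaces are finite-dimensional for
`m ≠ 0` (`finiteDimensional_highestWeightSpace_coordRep_holds`), so
`mult_χ k[Δ_m[f]] ≤ mult_χ k[Sym^m]`. [cite: BurgisserEtAl2011, §4.4 and §5.2] -/
theorem orbitMultiplicity_le_plethysmCoeff_holds :
    Literature.NumberTheory.DiophantineGeometry.orbitMultiplicity_le_plethysmCoeff (k := k) (σ := σ) := by
  intro _ f m hm _ χ
  haveI : FiniteDimensional k (Literature.NumberTheory.DiophantineGeometry.highestWeightSpace (coordRep σ k m) χ) :=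
    Literature.NumberTheory.DiophantineGeometry.finiteDimensional_highestWeightSpace_coordRep_holds hm χ
  exact hwMultiplicity_le_of_surjective
    (⟨(Ideal.Quotient.mkₐ k (orbitVanishingIdeal f m)).toLinearMap, fun _ => LinearMap.ext fun _ => rfl⟩ :
      (coordRep σ k m).IntertwiningMap (orbitCoordRep f m))
    (Ideal.Quotient.mkₐ_surjective k _) (isSemisimpleRepresentation_coordRep m) χ

end Principle

section OccurrenceGCT

open MvPolynomial

/-- **Occurrence obstructions are multiplicity obstructions** — discharge of the named fact
`hasMultiplicityObstruction_of_hasOccurrenceObstruction_complex` (file `GCTObstructions`;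
Bürgisser–Ikenmeyer–Panova 2019 §1). If an irreducible `W ≤ ℂ[Δ[g]]_d` admits no nonzero
equivariant map to `ℂ[Δ[f]]_d`, there is no equivariant surjection `ℂ[Δ[f]]_d ↠ ℂ[Δ[g]]_d`: by
complete reducibility of `ℂ[Δ[f]]_d` (`isSemisimpleRepresentation_orbitCoordRep`) such a surjection
would have an equivariant section, embedding `W` into `ℂ[Δ[f]]_d`.
[cite: BurgisserIkenmeyerPanova2019, §1] -/
theorem hasMultiplicityObstruction_of_hasOccurrenceObstruction_complex_holds :
    hasMultiplicityObstruction_of_hasOccurrenceObstruction_complex := by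
  intro σ _ _ f g m d _ _ hocc hsurj
  obtain ⟨W, hWle, hWirr, hW⟩ := hocc
  obtain ⟨φ, hφ⟩ := hsurj
  have hss : (orbitCoordRepDeg f m d).IsSemisimpleRepresentation :=
    Literature.NumberTheory.DiophantineGeometry.isSemisimpleRepresentation_toRepresentation (orbitCoordSubrep f m d)
      (isSemisimpleRepresentation_orbitCoordRep f m)
  obtain ⟨s, hs⟩ := exists_section_of_surjective φ hφ hss
  -- the inclusion `W → ℂ[Δ[g]]_d` followed by the section
  let ι : W.toRepresentation.IntertwiningMap (orbitCoordRepDeg g m d) :=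
    ⟨Submodule.inclusion hWle, fun A => rfl⟩
  have hψ := hW (s.comp ι)
  -- `W ≠ 0`, so the composite is nonzero: contradiction
  haveI := hWirr
  have hbt : (⊥ : Subrepresentation W.toRepresentation) ≠ ⊤ := bot_ne_top
  have hnt : Nontrivial W.toSubmodule := by
    by_contra hsub
    rw [not_nontrivial_iff_subsingleton] at hsub
    exact hbt (Subrepresentation.toSubmodule_injective (Subsingleton.elim _ _))
  obtain ⟨w, hw0⟩ := exists_ne (0 : W.toSubmodule)
  have h1 : φ (s (ι w)) = ι w := hs (ι w)
  have h2 : s (ι w) = 0 := by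
    have h := DFunLike.congr_fun hψ w
    rw [Representation.IntertwiningMap.comp_apply] at h
    exact h
  rw [h2, map_zero] at h1
  have h3 : Submodule.inclusion hWle w = Submodule.inclusion hWle 0 := by
    rw [map_zero]
    exact h1.symm
  exact hw0 (Submodule.inclusion_injective hWle h3)

end OccurrenceGCT

end Literature.Computability.AlgebraicComplexity
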